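import Summits.AtomisticToContinuum.HydrodynamicLimit.Theorems.OneFlightGossipEngineClampedCurrentsDockReduction
import Summits.AtomisticToContinuum.HydrodynamicLimit.Theorems.OneFlightGossipEngineClampedCurrentsDockGronwall
import Summits.AtomisticToContinuum.HydrodynamicLimit.Theorems.TwoClocksClampedEntropyClockTimeZeroReference
import HarnessLib

/-!
# Crux `ClampedCurrentsDock` (stmt-AtomisticToContinuum-14680), line `IdeatorTwoSketch`: the Gronwall end of the window ledger

Helper file (`--supports stmt-AtomisticToContinuum-14680`) of the line lead (continuation c1) for the registered
skeleton `Cruxes/ClampedCurrentsDock/Lines/IdeatorTwoSketch.lean`. The XL stub S7 `WindowLedger` of that skeleton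
(Yau's one-window relative-entropy ledger, fed by the restricted kinetic window LD, the LOCAL clamped
collisional-transfer LD, the activity / cubic tails and the coherent-suprathermal input, concluding the Gronwall core
`ClampedCurrentsDockReduction.RelEntropyCoreRf`) is cut here at its last joint: the ANALYTIC HEART of the ledger
delivers, along the explicit reference family `ψ_s = localGibbsLaw σ (ρ_s·Rf(σ³ρ_s)) (u s) (θ s)`, (i) an a-priori
bound of the relative entropies `H_N(s) = KL(lawAt Φ_N λ_N s ‖ ψ_s)` on `[0, t]` at every `N`, and (ii) the
INTEGRATED multi-window ledger inequality
`H_N(t′) ≤ (N+1) ε + K ∫₀^{t′} sup_{s ≤ r} H_N(s) dr` for all `t′ ≤ t`, eventually in `N`, at a rate `K` fixed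
before `ε` (this is the shape the MULTI-WINDOW ledger of the line naturally ends in: every additive term of the
entropy production is priced by the entropy inequality on ITS OWN window system, and the left Riemann sums of the
running supremum are dominated by its integral — the answer to the window-quantifier mismatch J1 of the crux's
disprover, KCWU being `∃ τ` while the collisional inputs are `∀ τ ≥ τ₀`). This file proves, sorry-free, that (i)+(ii)
— the proposition `LedgerIntegralCore` — imply the Gronwall core `RelEntropyCoreRf`:

* the time-`0` member of the reference family IS the initial law (`QuenchedCellClock.stub_timeZeroReference`, landed
  for the twin crux stmt-15145, imported — same Literature frame), so `H_N(0) = 0`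
  (`EntropyClockDock.klDiv_lawAt_zero_localGibbsLaw`);
* the running supremum `S_N(r) = sup_{s ∈ [0,r]} H_N(s)` is monotone, starts at `0`, is bounded by (i), and by (ii)
  satisfies `S_N(t′) ≤ (N+1)ε + K∫₀^{t′} S_N`; the landed S13 `ClampedCurrentsDockGronwall.stub_monotoneGronwall`
  gives `S_N(t) ≤ (N+1) ε e^{Kt}`, hence `H_N(t)/(N+1) ≤ ε e^{Kt}` eventually, i.e. `H_N(t)/(N+1) → 0`;
* `ℝ≥0∞` bookkeeping back to `klDiv / (N+1) → 0`.

So after this file the open residue of S7 is exactly the heart `LedgerIntegralCore` fed by the line's inputs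
(registered stub `stub_ledgerIntegral` of skeleton v12), and the skeleton's `stub_ledger : WindowLedger` is sorry-free
glue of `stub_ledgerIntegral` and this file's `stub_ledgerGronwall`.
-/

noncomputable section

namespace Summit.AtomisticToContinuum.HydrodynamicLimit.Theorems.ClampedCurrentsDockLedgerGlue

open scoped BigOperators ENNReal Classical
open MeasureTheory Filter Set Topology InformationTheory
open Literature.MathematicalPhysics.KineticTheory Literature.Analysis.FluidPDE Literature.Analysis.FunctionSpaces
open Summit.AtomisticToContinuum.HydrodynamicLimit.Theses.OneFlightGossipEngine
open Summit.AtomisticToContinuum.HydrodynamicLimit.Theorems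
open Summit.AtomisticToContinuum.HydrodynamicLimit.Theorems.EntropyClockDock

/-- **The integrated ledger (output of the analytic heart of S7).** Same frame and hypotheses as the Gronwall core
`ClampedCurrentsDockReduction.RelEntropyCoreRf` (insertion factor `Rf` with its four defining properties, `η₀` with
the matrix of `UniformLocalGibbsConcentration`, `HsEosLowDensity`, `DiluteSelfConsistency`, continuous positive
profiles, small `σ`, a classical hs-Euler solution tied at `t = 0`, a flow family, `t ∈ (0, T)`), concluding, with
`H_N(s) := KL(lawAt Φ_N λ_N s ‖ localGibbsLaw σ (ρ_s·Rf(σ³ρ_s)) (u s) (θ s))`: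
(i) for every `N` an a-priori bound `H_N(s) ≤ B_N` on `[0, t]` (crude: Gaussian moments + energy conservation);
(ii) `∃ K ≥ 0 ∀ ε > 0 ∃ N₀ ∀ N ≥ N₀ ∀ t′ ∈ [0, t]: H_N(t′) ≤ (N+1) ε + K ∫₀^{t′} sup_{s ∈ [0,r]} H_N(s) dr`
(`K = m/β`: `m` channels, tilt `β` fixed by the LD inputs before `ε`; the `ε`-term collects the window pressures,
the activity / cubic / coherence tails and the partial windows). A registered stub SIGNATURE of the line (route-internal
proposition in the vocabulary of the crux; Yau 1991 §2, Olla–Varadhan–Yau 1993 §3 for the method), not a cited fact. -/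
def LedgerIntegralCore : Prop :=
  ∀ (r : ℝ) (Rf : ℝ → ℝ), 0 < r →
    (∀ x ∈ Ioo (-r) r, 0 < Rf x ∧ Rf x * (∑' j : ℕ, bE j / (j.factorial : ℝ) * (x * Rf x) ^ j) = 1) →
    (∀ x ∈ Icc 0 r, 1 ≤ Rf x ∧ Rf x ≤ 2) → ContinuousOn Rf (Icc 0 r) →
    (∀ x ∈ Ioo (-r) r, ∀ R ∈ Icc (1 / 2 : ℝ) 2,
      R * (∑' j : ℕ, bE j / (j.factorial : ℝ) * (x * R) ^ j) = 1 → R = Rf x) →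
    ∀ η₀ : ℝ, 0 < η₀ →
    (∀ (a θ₀ : T3 → ℝ) (u₀ : T3 → V3), Continuous a → Continuous θ₀ → Continuous u₀ → (∀ x, 0 < a x) →
      (∀ x, 0 < θ₀ x) → ∀ σ : ℝ, 0 < σ → σ ^ 3 * (⨆ x, a x) ≤ η₀ * ∫ x, a x →
      ∃ ρ₀ : T3 → ℝ, Continuous ρ₀ ∧ (∀ x, 0 < ρ₀ x) ∧
        (∀ (N : ℕ) (Φ : HardSphereFlow (Torus.geometry (Fin 3)) (hsDiameter σ N) (N + 1)),
          IsProbabilityMeasure (localGibbsLaw σ a u₀ θ₀ N Φ)) ∧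
        ∀ χ : T3 → ℝ, Continuous χ → ∀ δ : ℝ, 0 < δ → ∃ C : ℝ, 0 < C ∧
          ∀ (N : ℕ) (Φ : HardSphereFlow (Torus.geometry (Fin 3)) (hsDiameter σ N) (N + 1)),
            localGibbsLaw σ a u₀ θ₀ N Φ {z | δ < |empiricalDensityField z χ - ∫ x, χ x * ρ₀ x|} ≤
                ENNReal.ofReal (C * Real.exp (-(C⁻¹ * ((N : ℝ) + 1)))) ∧
              localGibbsLaw σ a u₀ θ₀ N Φ
                  {z | δ < ‖empiricalMomentumField z χ - ∫ x, (χ x * ρ₀ x) • u₀ x‖} ≤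
                ENNReal.ofReal (C * Real.exp (-(C⁻¹ * ((N : ℝ) + 1)))) ∧
              localGibbsLaw σ a u₀ θ₀ N Φ {z | δ < |empiricalEnergyField z χ -
                  ∫ x, χ x * totalEnergyDensity (ρ₀ x) (u₀ x) (θ₀ x)|} ≤
                ENNReal.ofReal (C * Real.exp (-(C⁻¹ * ((N : ℝ) + 1))))) →
    HsEosLowDensity → DiluteSelfConsistency →
    ∀ (a₀ θ₀ : T3 → ℝ) (u₀ : T3 → V3), Continuous a₀ → Continuous θ₀ → Continuous u₀ →
      (∀ x, 0 < a₀ x) → (∀ x, 0 < θ₀ x) →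
      ∃ σ₀ : ℝ, 0 < σ₀ ∧ ∀ σ : ℝ, 0 < σ → σ < σ₀ →
        ∀ (T : ℝ) (ρ θ : ℝ → T3 → ℝ) (u : ℝ → T3 → V3), IsHardSphereEulerSolution σ T ρ u θ →
          ∀ Φ : (N : ℕ) → HardSphereFlow (Torus.geometry (Fin 3)) (hsDiameter σ N) (N + 1),
            TendstoHydroFieldsAt (fun N => localGibbsLaw σ a₀ u₀ θ₀ N (Φ N)) Φ ρ u θ 0 →
            ∀ t ∈ Set.Ioo 0 T,
              (∀ N : ℕ, ∃ B : ℝ, ∀ s ∈ Set.Icc 0 t,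
                klDiv ((Φ N).lawAt (localGibbsLaw σ a₀ u₀ θ₀ N (Φ N)) s)
                  (localGibbsLaw σ (fun x => ρ s x * Rf (σ ^ 3 * ρ s x)) (u s) (θ s) N (Φ N)) ≤
                  ENNReal.ofReal B) ∧
              ∃ K : ℝ, 0 ≤ K ∧ ∀ ε : ℝ, 0 < ε → ∃ N₀ : ℕ, ∀ N : ℕ, N₀ ≤ N → ∀ t' ∈ Set.Icc 0 t,
                (klDiv ((Φ N).lawAt (localGibbsLaw σ a₀ u₀ θ₀ N (Φ N)) t')
                  (localGibbsLaw σ (fun x => ρ t' x * Rf (σ ^ 3 * ρ t' x)) (u t') (θ t') N (Φ N))).toReal ≤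
                ((N : ℝ) + 1) * ε + K * ∫ r in (0 : ℝ)..t',
                  sSup ((fun s => (klDiv ((Φ N).lawAt (localGibbsLaw σ a₀ u₀ θ₀ N (Φ N)) s)
                    (localGibbsLaw σ (fun x => ρ s x * Rf (σ ^ 3 * ρ s x)) (u s) (θ s) N (Φ N))).toReal) ''
                    Set.Icc 0 r)

/-- **Running-supremum Gronwall (real analysis).** If `H` is bounded above on `[0, t]`, `H 0 = 0`, and
`H t′ ≤ C + K ∫₀^{t′} S` for all `t′ ∈ [0, t]` with `S r := sup (H '' [0, r])`, `K ≥ 0`, then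
`H t ≤ C · e^{K t}` — via the landed monotone Gronwall `ClampedCurrentsDockGronwall.stub_monotoneGronwall` applied
to the nondecreasing envelope `S`. [folklore] -/
theorem le_mul_exp_of_integral_sSup {H : ℝ → ℝ} {t C K B : ℝ} (ht : 0 ≤ t) (hK : 0 ≤ K)
    (hHB : ∀ s ∈ Icc 0 t, H s ≤ B) (hzero : H 0 = 0)
    (hstep : ∀ t' ∈ Icc 0 t, H t' ≤ C + K * ∫ r in (0 : ℝ)..t', sSup (H '' Icc 0 r)) :
    H t ≤ C * Real.exp (K * t) := by
  -- the running supremum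
  set S : ℝ → ℝ := fun r => sSup (H '' Icc 0 r) with hS
  have hbdd : ∀ r ∈ Icc 0 t, BddAbove (H '' Icc 0 r) := by
    intro r hr
    refine ⟨B, ?_⟩
    rintro y ⟨s, hs, rfl⟩
    exact hHB s ⟨hs.1, hs.2.trans hr.2⟩
  have hne : ∀ r ∈ Icc 0 t, (H '' Icc 0 r).Nonempty := fun r hr =>
    ⟨H 0, 0, ⟨le_rfl, hr.1⟩, rfl⟩
  have hHS : ∀ r ∈ Icc 0 t, H r ≤ S r := fun r hr =>
    le_csSup (hbdd r hr) ⟨r, ⟨hr.1, le_rfl⟩, rfl⟩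
  have hS0 : S 0 = 0 := by
    show sSup (H '' Icc 0 0) = 0
    rw [Icc_self, image_singleton, csSup_singleton, hzero]
  have hSnn : ∀ r ∈ Icc 0 t, 0 ≤ S r := fun r hr =>
    calc (0 : ℝ) = H 0 := hzero.symm
      _ ≤ S r := le_csSup (hbdd r hr) ⟨0, ⟨le_rfl, hr.1⟩, rfl⟩
  have hmono : MonotoneOn S (Icc 0 t) := by
    intro r₁ hr₁ r₂ hr₂ h12
    exact csSup_le_csSup (hbdd r₂ hr₂) (hne r₁ hr₁) (image_mono (Icc_subset_Icc le_rfl h12))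
  -- the envelope satisfies the integral inequality
  have hineq : ∀ t' ∈ Icc 0 t, S t' ≤ C + K * ∫ r in (0 : ℝ)..t', S r := by
    intro t' ht'
    refine csSup_le (hne t' ht') ?_
    rintro y ⟨s, hs, rfl⟩
    have hst : s ∈ Icc 0 t := ⟨hs.1, hs.2.trans ht'.2⟩
    refine (hstep s hst).trans (add_le_add le_rfl (mul_le_mul_of_nonneg_left ?_ hK))
    -- `∫₀ˢ S ≤ ∫₀^{t'} S` for the nonnegative, monotone (hence integrable) envelope
    have hint : IntervalIntegrable S volume 0 t' := by
      refine (hmono.mono ?_).intervalIntegrable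
      rw [uIcc_of_le ht'.1]
      exact Icc_subset_Icc le_rfl ht'.2
    have hnn : (0 : ℝ → ℝ) ≤ᵐ[volume.restrict (Ioc (0 : ℝ) t')] S :=
      ae_restrict_of_forall_mem (measurableSet_Ioc : MeasurableSet (Ioc (0 : ℝ) t')) fun x hx =>
        hSnn x ⟨hx.1.le, hx.2.trans ht'.2⟩
    exact intervalIntegral.integral_mono_interval le_rfl hs.1 hs.2 hnn hint
  have hG := ClampedCurrentsDockGronwall.stub_monotoneGronwall S C K t hK ht hmono hS0.symm.le hineq
  exact (hHS t ⟨ht, le_rfl⟩).trans hG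

/-- **S7c — the Gronwall end of the ledger (statement; registered stub `stub_ledgerGronwall` of skeleton v12).** The
integrated ledger implies the Gronwall core: `LedgerIntegralCore → RelEntropyCoreRf` (the latter verbatim the landed
`ClampedCurrentsDockReduction.RelEntropyCoreRf`, hypothesis of the landed reduction S1 `stub_reduction`). Route-internal
stub signature, not a cited fact. -/
def LedgerGronwallEnd : Prop :=
  LedgerIntegralCore → ClampedCurrentsDockReduction.RelEntropyCoreRf

/-- **STUB S7c `stub_ledgerGronwall` of line `IdeatorTwoSketch` (crux `ClampedCurrentsDock`, stmt-14680): the integrated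
ledger implies the Gronwall core.** Time zero by `QuenchedCellClock.stub_timeZeroReference` (twin crux 15145, landed)
and `klDiv_lawAt_zero_localGibbsLaw`; Gronwall on the running supremum by `le_mul_exp_of_integral_sSup`; then `ℝ≥0∞`
bookkeeping. [cite: Yau1991, §2] -/
theorem stub_ledgerGronwall : LedgerGronwallEnd := by
  intro hL r Rf hr hsol hbd hcont huniq η₀ hη₀ HU hEos hS a₀ θ₀ u₀ ha hθ hu ha0 hθ0
  obtain ⟨σ₁, hσ₁, H1⟩ := hL r Rf hr hsol hbd hcont huniq η₀ hη₀ HU hEos hS a₀ θ₀ u₀ ha hθ hu ha0 hθ0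
  obtain ⟨σ₂, hσ₂, H2⟩ :=
    QuenchedCellClock.stub_timeZeroReference hr hsol hbd hcont huniq a₀ θ₀ u₀ ha hθ hu ha0 hθ0
  refine ⟨min σ₁ (min σ₂ (1 / 2)), lt_min hσ₁ (lt_min hσ₂ (by norm_num)), ?_⟩
  intro σ hσ hσlt T ρ θ u hE Φ htie t ht _hac _hap _hale _hQs _hlim
  have hσ1 : σ < σ₁ := hσlt.trans_le (min_le_left _ _)
  have hσ2 : σ < σ₂ := hσlt.trans_le ((min_le_right _ _).trans (min_le_left _ _))
  have hσh : σ ≤ 1 / 2 := (hσlt.trans_le ((min_le_right _ _).trans (min_le_right _ _))).le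
  have hT : 0 < T := ht.1.trans ht.2
  obtain ⟨hB, K, hK, hstep⟩ := H1 σ hσ hσ1 T ρ θ u hE Φ htie t ht
  have hlaw := H2 σ hσ hσ2 T ρ θ u hE hT Φ htie
  -- the real-valued entropies along the explicit reference family
  set H : ℕ → ℝ → ℝ := fun N s =>
    (klDiv ((Φ N).lawAt (localGibbsLaw σ a₀ u₀ θ₀ N (Φ N)) s)
      (localGibbsLaw σ (fun x => ρ s x * Rf (σ ^ 3 * ρ s x)) (u s) (θ s) N (Φ N))).toReal with hH
  have hHnn : ∀ N s, 0 ≤ H N s := fun N s => ENNReal.toReal_nonneg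
  have hH0 : ∀ N, H N 0 = 0 := by
    intro N
    simp only [hH, hlaw N, klDiv_lawAt_zero_localGibbsLaw hσh ha hθ hu ha0 hθ0 N (Φ N),
      ENNReal.toReal_zero]
  -- the real claim: `H N t / (N+1) → 0`
  have hreal : Tendsto (fun N : ℕ => H N t / ((N : ℝ) + 1)) atTop (𝓝 0) := by
    rw [Metric.tendsto_atTop]
    intro δ hδ
    set ε : ℝ := δ / (2 * Real.exp (K * t)) with hε
    have hεpos : 0 < ε := by positivity
    obtain ⟨N₀, hN₀⟩ := hstep ε hεpos
    refine ⟨N₀, fun N hN => ?_⟩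
    have hNpos : (0 : ℝ) < (N : ℝ) + 1 := by positivity
    obtain ⟨B, hBN⟩ := hB N
    -- a-priori bound in real form
    have hHB : ∀ s ∈ Icc 0 t, H N s ≤ max B 0 := by
      intro s hs
      exact ENNReal.toReal_le_of_le_ofReal (le_max_right _ _)
        ((hBN s hs).trans (ENNReal.ofReal_le_ofReal (le_max_left _ _)))
    have hmain : H N t ≤ ((N : ℝ) + 1) * ε * Real.exp (K * t) :=
      le_mul_exp_of_integral_sSup (H := H N) ht.1.le hK hHB (hH0 N) (fun t' ht' => hN₀ N hN t' ht')
    have hval : ((N : ℝ) + 1) * ε * Real.exp (K * t) = ((N : ℝ) + 1) * (δ / 2) := by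
      have hexp : Real.exp (K * t) ≠ 0 := (Real.exp_pos _).ne'
      rw [hε]
      field_simp
    have hq : H N t / ((N : ℝ) + 1) ≤ δ / 2 := by
      rw [div_le_iff₀ hNpos]
      calc H N t ≤ ((N : ℝ) + 1) * ε * Real.exp (K * t) := hmain
        _ = ((N : ℝ) + 1) * (δ / 2) := hval
        _ = δ / 2 * ((N : ℝ) + 1) := by ring
    have hq0 : 0 ≤ H N t / ((N : ℝ) + 1) := div_nonneg (hHnn N t) hNpos.le
    rw [Real.dist_eq, sub_zero, abs_of_nonneg hq0]
    linarith
  -- back to `ℝ≥0∞`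
  have hfin : ∀ N : ℕ, klDiv ((Φ N).lawAt (localGibbsLaw σ a₀ u₀ θ₀ N (Φ N)) t)
      (localGibbsLaw σ (fun x => ρ t x * Rf (σ ^ 3 * ρ t x)) (u t) (θ t) N (Φ N)) ≠ ⊤ := by
    intro N
    obtain ⟨B, hBN⟩ := hB N
    exact ne_top_of_le_ne_top ENNReal.ofReal_ne_top (hBN t ⟨ht.1.le, le_rfl⟩)
  have hcongr : ∀ N : ℕ, klDiv ((Φ N).lawAt (localGibbsLaw σ a₀ u₀ θ₀ N (Φ N)) t)
      (localGibbsLaw σ (fun x => ρ t x * Rf (σ ^ 3 * ρ t x)) (u t) (θ t) N (Φ N)) / ((N : ℝ≥0∞) + 1) =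
      ENNReal.ofReal (H N t / ((N : ℝ) + 1)) := by
    intro N
    have hNpos : (0 : ℝ) < (N : ℝ) + 1 := by positivity
    rw [ENNReal.ofReal_div_of_pos hNpos, hH, ENNReal.ofReal_toReal (hfin N)]
    congr 1
    rw [ENNReal.ofReal_add (by positivity) zero_le_one, ENNReal.ofReal_natCast, ENNReal.ofReal_one]
  simp only [hcongr]
  rw [← ENNReal.ofReal_zero]
  exact ENNReal.tendsto_ofReal hreal

end Summit.AtomisticToContinuum.HydrodynamicLimit.Theorems.ClampedCurrentsDockLedgerGlue

end
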